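import Summits.PneNP.PneNP.Theses.BavardGap

/-!
# Route BavardGap — counting cycles by orbit minima (helper for `PgDecisionInNP`, stmt-PneNP-2498)

The verifier of the pairing-genus language counts the cycles of the permutation `σ = (finRotate n) ∘ π` — ALL cycles,
fixed points included, i.e. `card (cycleType σ) + #{c | σ c = c}` — as the number of ORBIT MINIMA `#{i | ∀ k, i ≤ σᵏ i}`
(`bavardGap_card_orbitMin`: fixed points are their own minima; the moved minima correspond to the cycle factors through
`i ↦ σ.cycleOf i`), and an orbit minimum is recognised by looking at the first `n` iterates only
(`bavardGap_orbitMin_iff_bounded`).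
-/

set_option linter.dupNamespace false -- `Summit.PneNP.PneNP.…`: summit = sub-problem name (D-0017 single-conjunct layout)

namespace Summit.PneNP.PneNP.Theorems

open Finset Equiv.Perm

open Classical in
/-- **Cycles, fixed points included, are counted by orbit minima.** [folklore] -/
theorem bavardGap_card_orbitMin {n : ℕ} (σ : Equiv.Perm (Fin n)) :
    (univ.filter fun i : Fin n => ∀ k : ℕ, i ≤ (σ ^ k) i).card =
      Multiset.card σ.cycleType + (univ.filter fun c : Fin n => σ c = c).card := by
  classical
  -- split the minima into moved and fixed ones
  have hsplit := card_filter_add_card_filter_not (s := univ.filter fun i : Fin n => ∀ k : ℕ, i ≤ (σ ^ k) i)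
    (fun i : Fin n => ¬ σ i = i)
  rw [filter_filter, filter_filter] at hsplit
  rw [← hsplit]
  congr 1
  · -- moved minima ↔ cycle factors
    rw [cycleType_def, Multiset.card_map, card_val]
    refine card_bij (fun i _ => σ.cycleOf i) (fun i hi => ?_) (fun i hi j hj h => ?_) (fun c hc => ?_)
    · simp only [mem_filter, mem_univ, true_and] at hi
      exact cycleOf_mem_cycleFactorsFinset_iff.2 (mem_support.2 hi.2)
    · simp only [mem_filter, mem_univ, true_and] at hi hj
      have hjs : j ∈ (σ.cycleOf j).support := mem_support_cycleOf_iff.2 ⟨SameCycle.refl _ _, mem_support.2 hj.2⟩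
      rw [← h] at hjs
      have hs : SameCycle σ i j := (mem_support_cycleOf_iff.1 hjs).1
      obtain ⟨k, -, hk⟩ := hs.exists_pow_eq'
      obtain ⟨k', -, hk'⟩ := hs.symm.exists_pow_eq'
      exact le_antisymm (hk ▸ hi.1 k) (hk' ▸ hj.1 k')
    · obtain ⟨hcyc, hcσ⟩ := mem_cycleFactorsFinset_iff.1 hc
      obtain ⟨a, ha, -⟩ := hcyc
      have has : a ∈ c.support := mem_support.2 ha
      have haσ : a ∈ σ.support := by
        rw [mem_support, ← hcσ a has]; exact ha
      have hca : c = σ.cycleOf a := cycle_is_cycleOf has hc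
      set S := (σ.cycleOf a).support with hS
      have hne : S.Nonempty := ⟨a, mem_support_cycleOf_iff.2 ⟨SameCycle.refl _ _, haσ⟩⟩
      set m := S.min' hne with hm
      have hmS : m ∈ S := min'_mem S hne
      have ham : SameCycle σ a m := (mem_support_cycleOf_iff.1 hmS).1
      refine ⟨m, ?_, ?_⟩
      · simp only [mem_filter, mem_univ, true_and]
        refine ⟨fun k => ?_, ?_⟩
        · refine min'_le S _ (mem_support_cycleOf_iff.2 ⟨ham.trans ⟨k, by simp⟩, haσ⟩)
        · exact mem_support.1 (support_cycleOf_le σ a hmS)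
      · rw [hca]; exact (ham.cycleOf_eq).symm
  · -- fixed points are minima
    congr 1
    ext i
    simp only [mem_filter, mem_univ, true_and, not_not, and_iff_right_iff_imp]
    intro h k
    rw [pow_apply_eq_self_of_apply_eq_self h]

/-- **Orbit minima are recognised on the first `n` iterates.** [folklore] -/
theorem bavardGap_orbitMin_iff_bounded {n : ℕ} (σ : Equiv.Perm (Fin n)) (i : Fin n) :
    (∀ k : ℕ, i ≤ (σ ^ k) i) ↔ ∀ k : ℕ, k < n → i ≤ (σ ^ k) i := by
  classical
  refine ⟨fun h k _ => h k, fun h k => ?_⟩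
  by_cases hfix : σ i = i
  · rw [pow_apply_eq_self_of_apply_eq_self hfix]
  · rw [← pow_mod_card_support_cycleOf_self_apply]
    refine h _ (lt_of_lt_of_le (Nat.mod_lt _ ?_) ?_)
    · exact card_pos.2 ⟨i, mem_support_cycleOf_iff.2 ⟨SameCycle.refl _ _, mem_support.2 hfix⟩⟩
    · exact (card_le_univ _).trans (by simp)

end Summit.PneNP.PneNP.Theorems
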